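import Summits.Ventures.HodgeRepro2.T5SU11SphericalLegendreLaplace

/-!
# Legendre identities from Bonnet's recursion: `x P'_{n+1} − P'_n = (n+1) P_{n+1}`, `P'_{n+2} − P'_n = (2n+3) P_{n+1}`,
the integration formula, the Christoffel–Darboux formula and its confluent form; the spherical version

All from the two identities of `T5SU11SphericalLegendreAll.legendre_identities` and Bonnet's recursion, by algebra:

* **`x P'_{n+1} − P'_n = (n + 1) P_{n+1}`** (`mul_legQ_succ_sub_legQ`) and **`P'_{n+2} − P'_n = (2n + 3) P_{n+1}`**
  (`legQ_succ_succ_sub_legQ`), hence the classical integration formula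
  **`∫_a^b P_{n+1} = [(P_{n+2} − P_n)/(2n + 3)]_a^b`** (`integral_legP_succ`) and **`∫_{−1}^{1} P_{n+1} = 0`**
  (`integral_legP_succ_neg_one_one`);
* **the Christoffel–Darboux formula**
  **`(x − y) Σ_{k ≤ n} (2k + 1) P_k(x) P_k(y) = (n + 1)(P_{n+1}(x) P_n(y) − P_n(x) P_{n+1}(y))`** (`christoffel_darboux`),
  by induction with Bonnet's recursion, and its **confluent form**
  **`Σ_{k ≤ n} (2k + 1) P_k(x)² = (n + 1)(P_n(x) P'_{n+1}(x) − P_{n+1}(x) P'_n(x))`** (`christoffel_darboux_confluent`),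
  read off by differentiating `y ↦ (x − y) S(y)` at `y = x`; on `[1, ∞)` the right side is `> 0`, so **the ratio
  `P_{n+1}/P_n` is strictly increasing on `[1, ∞)`** (`legP_mul_legQ_succ_sub_pos`, `strictMonoOn_legP_succ_div`);
* on the group, with `φ_{2k+2} = P_k(φ_4)`: **`(φ_4(g) − φ_4(h)) Σ_{k ≤ n} (2k + 1) φ_{2k+2}(g) φ_{2k+2}(h)
  = (n + 1)(φ_{2n+4}(g) φ_{2n+2}(h) − φ_{2n+2}(g) φ_{2n+4}(h))`** (`sph_christoffel_darboux`) — the Christoffel–Darboux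
  formula for the spherical functions of even integer parameter, and `t ↦ φ_{2n+4}(a_t)/φ_{2n+2}(a_t)` is strictly
  increasing on `[0, ∞)` (`strictMonoOn_sph_even_succ_div_hyp`).

Nothing is claimed about (N).

Blind lane: Mathlib + the HodgeRepro2 prefix only; no sorry; axioms ⊆ {propext, Classical.choice,
Quot.sound}.
-/

namespace Summit.Ventures.HodgeRepro2.T5SU11LegendreIdentities

open MeasureTheory Metric Set Filter Topology Finset intervalIntegral
open T5SU11Unimodular T5SU11Cartan T5SU11SphericalFunction T5SU11SphericalLegendreAll T5SU11SphericalLegendreLaplace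

/-- `P_n` is continuous (it is differentiable). -/
theorem continuous_legP (n : ℕ) : Continuous (legP n) :=
  continuous_iff_continuousAt.mpr fun x => (hasDerivAt_legP n x).continuousAt

/-! ### Two more derivative identities -/

/-- **`x P'_{n+1} − P'_n = (n + 1) P_{n+1}`.** -/
theorem mul_legQ_succ_sub_legQ (n : ℕ) (x : ℝ) :
    x * legQ (n + 1) x - legQ n x = ((n : ℝ) + 1) * legP (n + 1) x := by
  obtain ⟨h1, h2⟩ := legendre_identities n x
  linear_combination x * h1 + h2

/-- **`P'_{n+2} − P'_n = (2n + 3) P_{n+1}`.** -/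
theorem legQ_succ_succ_sub_legQ (n : ℕ) (x : ℝ) :
    legQ (n + 2) x - legQ n x = (2 * (n : ℝ) + 3) * legP (n + 1) x := by
  have h1 := (legendre_identities (n + 1) x).1
  have h2 := mul_legQ_succ_sub_legQ n x
  push_cast at h1
  linear_combination h1 + h2

/-- `(P_{n+2} − P_n)/(2n + 3)` is an antiderivative of `P_{n+1}`. -/
theorem hasDerivAt_legP_antideriv (n : ℕ) (x : ℝ) :
    HasDerivAt (fun y => (legP (n + 2) y - legP n y) / (2 * (n : ℝ) + 3)) (legP (n + 1) x) x := by
  have h := ((hasDerivAt_legP (n + 2) x).sub (hasDerivAt_legP n x)).div_const (2 * (n : ℝ) + 3)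
  refine h.congr_deriv ?_
  rw [legQ_succ_succ_sub_legQ]
  field_simp

/-- **The integration formula `∫_a^b P_{n+1} = [(P_{n+2} − P_n)/(2n + 3)]_a^b`.** -/
theorem integral_legP_succ (n : ℕ) (a b : ℝ) :
    ∫ x in a..b, legP (n + 1) x
      = (legP (n + 2) b - legP n b) / (2 * (n : ℝ) + 3) - (legP (n + 2) a - legP n a) / (2 * (n : ℝ) + 3) := by
  refine integral_eq_sub_of_hasDerivAt (fun x _ => hasDerivAt_legP_antideriv n x) ?_
  exact (continuous_legP (n + 1)).intervalIntegrable a b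

/-- **`∫_{−1}^{1} P_{n+1} = 0`**: the Legendre polynomials of positive degree have mean zero on `[−1, 1]`. -/
theorem integral_legP_succ_neg_one_one (n : ℕ) : ∫ x in (-1 : ℝ)..1, legP (n + 1) x = 0 := by
  rw [integral_legP_succ, legP_one, legP_one, legP_neg_one, legP_neg_one, pow_succ, pow_succ]
  ring

/-! ### The Christoffel–Darboux formula -/

/-- **The Christoffel–Darboux formula**
`(x − y) Σ_{k ≤ n} (2k + 1) P_k(x) P_k(y) = (n + 1)(P_{n+1}(x) P_n(y) − P_n(x) P_{n+1}(y))`. -/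
theorem christoffel_darboux (n : ℕ) (x y : ℝ) :
    (x - y) * ∑ k ∈ range (n + 1), (2 * (k : ℝ) + 1) * legP k x * legP k y
      = ((n : ℝ) + 1) * (legP (n + 1) x * legP n y - legP n x * legP (n + 1) y) := by
  induction n with
  | zero => simp
  | succ n ih =>
    rw [Finset.sum_range_succ, mul_add, ih]
    have hn : ((n : ℝ) + 2) ≠ 0 := by positivity
    have hx := legP_succ_succ n x
    have hy := legP_succ_succ n y
    rw [eq_div_iff hn] at hx hy
    rw [show n + 1 + 1 = n + 2 from rfl]
    push_cast
    linear_combination (-(legP (n + 1) y)) * hx + legP (n + 1) x * hy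

/-- The finite sum `S(y) = Σ_{k ≤ n} (2k + 1) P_k(x) P_k(y)` is differentiable in `y`. -/
theorem hasDerivAt_cd_sum (n : ℕ) (x y : ℝ) :
    HasDerivAt (fun y => ∑ k ∈ range (n + 1), (2 * (k : ℝ) + 1) * legP k x * legP k y)
      (∑ k ∈ range (n + 1), (2 * (k : ℝ) + 1) * legP k x * legQ k y) y := by
  have h := HasDerivAt.sum (u := range (n + 1))
    (A := fun k y => (2 * (k : ℝ) + 1) * legP k x * legP k y)
    (A' := fun k => (2 * (k : ℝ) + 1) * legP k x * legQ k y) fun k _ => (hasDerivAt_legP k y).const_mul _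
  refine h.congr_of_eventuallyEq (Filter.Eventually.of_forall fun y => ?_)
  simp only [Finset.sum_apply]

/-- **The confluent Christoffel–Darboux formula**
`Σ_{k ≤ n} (2k + 1) P_k(x)² = (n + 1)(P_n(x) P'_{n+1}(x) − P_{n+1}(x) P'_n(x))`. -/
theorem christoffel_darboux_confluent (n : ℕ) (x : ℝ) :
    ∑ k ∈ range (n + 1), (2 * (k : ℝ) + 1) * legP k x ^ 2
      = ((n : ℝ) + 1) * (legP n x * legQ (n + 1) x - legP (n + 1) x * legQ n x) := by
  -- differentiate both sides of Christoffel–Darboux in `y` at `y = x`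
  set S : ℝ → ℝ := fun y => ∑ k ∈ range (n + 1), (2 * (k : ℝ) + 1) * legP k x * legP k y with hS
  have hL : HasDerivAt (fun y => (x - y) * S y) (-1 * S x + (x - x) * deriv S x) x := by
    have hd : HasDerivAt S (∑ k ∈ range (n + 1), (2 * (k : ℝ) + 1) * legP k x * legQ k x) x :=
      hasDerivAt_cd_sum n x x
    have h := ((hasDerivAt_id x).const_sub x).mul hd
    rw [hd.deriv]
    refine h.congr_deriv ?_
    simp only [id]
  have hR : HasDerivAt (fun y => ((n : ℝ) + 1) * (legP (n + 1) x * legP n y - legP n x * legP (n + 1) y))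
      (((n : ℝ) + 1) * (legP (n + 1) x * legQ n x - legP n x * legQ (n + 1) x)) x := by
    have h := (((hasDerivAt_legP n x).const_mul (legP (n + 1) x)).sub
      ((hasDerivAt_legP (n + 1) x).const_mul (legP n x))).const_mul ((n : ℝ) + 1)
    exact h
  have hfun : (fun y => (x - y) * S y)
      = fun y => ((n : ℝ) + 1) * (legP (n + 1) x * legP n y - legP n x * legP (n + 1) y) := by
    funext y
    exact christoffel_darboux n x y
  rw [hfun] at hL
  have := hL.unique hR
  have hSx : S x = ∑ k ∈ range (n + 1), (2 * (k : ℝ) + 1) * legP k x ^ 2 := by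
    simp only [hS]
    refine Finset.sum_congr rfl fun k _ => ?_
    ring
  rw [hSx] at this
  linear_combination -this

/-- **`P_n P'_{n+1} − P_{n+1} P'_n > 0` on `[1, ∞)`** (every term of the confluent sum is `≥ 1`). -/
theorem legP_mul_legQ_succ_sub_pos (n : ℕ) {x : ℝ} (hx : 1 ≤ x) :
    0 < legP n x * legQ (n + 1) x - legP (n + 1) x * legQ n x := by
  letI : MeasurableSpace Circle := borel Circle
  haveI : BorelSpace Circle := ⟨rfl⟩
  have h := christoffel_darboux_confluent n x
  have hpos : 0 < ∑ k ∈ range (n + 1), (2 * (k : ℝ) + 1) * legP k x ^ 2 :=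
    Finset.sum_pos (fun k _ => by
      have := one_le_legP k hx
      positivity) ⟨0, by simp⟩
  have hn : (0 : ℝ) < (n : ℝ) + 1 := by positivity
  rw [h] at hpos
  exact pos_of_mul_pos_right hpos hn.le

/-- The derivative of the ratio `P_{n+1}/P_n` on `[1, ∞)` is `(P_n P'_{n+1} − P_{n+1} P'_n)/P_n² > 0`. -/
theorem hasDerivAt_legP_succ_div (n : ℕ) {x : ℝ} (hx : 1 ≤ x) :
    HasDerivAt (fun y => legP (n + 1) y / legP n y)
      ((legQ (n + 1) x * legP n x - legP (n + 1) x * legQ n x) / legP n x ^ 2) x := by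
  letI : MeasurableSpace Circle := borel Circle
  haveI : BorelSpace Circle := ⟨rfl⟩
  exact (hasDerivAt_legP (n + 1) x).div (hasDerivAt_legP n x) (legP_ne_zero_of_one_le n hx)

/-- **The ratio `P_{n+1}/P_n` is strictly increasing on `[1, ∞)`.** -/
theorem strictMonoOn_legP_succ_div (n : ℕ) : StrictMonoOn (fun y => legP (n + 1) y / legP n y) (Ici 1) := by
  refine strictMonoOn_of_deriv_pos (convex_Ici 1) ?_ fun x hx => ?_
  · letI : MeasurableSpace Circle := borel Circle
    haveI : BorelSpace Circle := ⟨rfl⟩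
    exact ContinuousOn.div (continuous_legP (n + 1)).continuousOn (continuous_legP n).continuousOn
      fun x hx => legP_ne_zero_of_one_le n (mem_Ici.mp hx)
  · rw [interior_Ici] at hx
    have hx' : 1 ≤ x := le_of_lt (mem_Ioi.mp hx)
    rw [(hasDerivAt_legP_succ_div n hx').deriv]
    letI : MeasurableSpace Circle := borel Circle
    haveI : BorelSpace Circle := ⟨rfl⟩
    have h := legP_mul_legQ_succ_sub_pos n hx'
    have hP : 0 < legP n x ^ 2 := by
      have := legP_ne_zero_of_one_le n hx'
      positivity
    apply div_pos _ hP
    linarith [h]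

/-! ### On the group -/

section measure

variable [MeasurableSpace Circle] [BorelSpace Circle]

/-- **The Christoffel–Darboux formula for the spherical functions of even parameter**:
`(φ_4(g) − φ_4(h)) Σ_{k ≤ n} (2k + 1) φ_{2k+2}(g) φ_{2k+2}(h) = (n + 1)(φ_{2n+4}(g) φ_{2n+2}(h) − φ_{2n+2}(g) φ_{2n+4}(h))`. -/
theorem sph_christoffel_darboux (n : ℕ) (g h : SU11) :
    (sph 4 g - sph 4 h) * ∑ k ∈ range (n + 1), (2 * (k : ℝ) + 1) * sph (2 * (k : ℝ) + 2) g * sph (2 * (k : ℝ) + 2) h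
      = ((n : ℝ) + 1) * (sph (2 * ((n : ℝ) + 1) + 2) g * sph (2 * (n : ℝ) + 2) h
          - sph (2 * (n : ℝ) + 2) g * sph (2 * ((n : ℝ) + 1) + 2) h) := by
  have e : ∀ m : ℕ, ∀ u : SU11, sph (2 * (m : ℝ) + 2) u = legP m (sph 4 u) := fun m u => sph_even_eq_sph_four m u
  have e1 : ∀ u : SU11, sph (2 * ((n : ℝ) + 1) + 2) u = legP (n + 1) (sph 4 u) := fun u => by
    have := e (n + 1) u
    push_cast at this
    exact this
  simp only [e, e1]
  exact christoffel_darboux n (sph 4 g) (sph 4 h)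

/-- **`t ↦ φ_{2n+4}(a_t)/φ_{2n+2}(a_t)` is strictly increasing on `[0, ∞)`.** -/
theorem strictMonoOn_sph_even_succ_div_hyp (n : ℕ) :
    StrictMonoOn (fun t => sph (2 * ((n : ℝ) + 1) + 2) (hyp t) / sph (2 * (n : ℝ) + 2) (hyp t)) (Ici 0) := by
  intro s hs t ht hst
  have e1 : ∀ u, sph (2 * ((n : ℝ) + 1) + 2) (hyp u) = legP (n + 1) (Real.cosh (2 * u)) := fun u => by
    have := sph_even_hyp (n + 1) u
    push_cast at this
    exact this
  simp only [e1, sph_even_hyp]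
  have hcs : 1 ≤ Real.cosh (2 * s) := Real.one_le_cosh _
  have hlt : Real.cosh (2 * s) < Real.cosh (2 * t) := by
    rw [← Real.cosh_abs (2 * s), ← Real.cosh_abs (2 * t), abs_of_nonneg (by linarith [mem_Ici.mp hs]),
      abs_of_nonneg (by linarith [mem_Ici.mp ht])]
    exact Real.cosh_lt_cosh.mpr (by
      rw [abs_of_nonneg (by linarith [mem_Ici.mp hs]), abs_of_nonneg (by linarith [mem_Ici.mp ht])]
      linarith)
  exact strictMonoOn_legP_succ_div n (mem_Ici.mpr hcs) (mem_Ici.mpr (hcs.trans hlt.le)) hlt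

end measure

end Summit.Ventures.HodgeRepro2.T5SU11LegendreIdentities
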